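import Summits.Ventures.QEC.Census.CertBZPlaneSeg2
import Summits.Ventures.QEC.Census.BB.A1s_n186_k10_42ba7993.Cert
import HarnessLib

/-!
# `A1s_n186_k10_42ba7993` — side Z lane FAMILIES, packed module 38/42 (qec-search-10 g4 packfam.py: parts BZPlaneFamZ1m1p14;
# — split piece `BZPlaneFamZP37S2` (3/3 of `BZPlaneFamZP37`, qec-search-10 g5 splitfam.py: Σ lanes 11527409, 3 theorems; the one-level `segOK` parts run ≈ 4× slower per lane at the gate) at tier KERNEL — type-01 lane engine δ (`Plane.segOK` / `Plane.seg2OK`, Census/CertBZPlaneSeg2.lean);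
# assembled by the block files `BZPlaneBlkZP*.lean`. First part's header:
# # `A1s_n186_k10_42ba7993` — certificate `28a8c3e9cd9695fa…`, side Z, block 1, matrix 1 (depth 6, 93 rows): lane FAMILIES part 15/19
# # (12 theorems, Σ lanes 41621294) at tier KERNEL — type-01 lane engine δ (`Plane.segOK` one-level segments for largest rows `< 40`;
# # per larger row a singleton + `Plane.seg2OK` second-row ranges, Census/CertBZPlaneSeg2.lean); assembled by `BZPlaneBlkZ01.lean` (qec-search-10 g3 emit_bbrow.py)
-/

set_option autoImplicit false
set_option Elab.async false

namespace Summit.Ventures.QEC.Census.A1s_n186_k10_42ba7993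

open Summit.Ventures.QEC.Census Summit.Ventures.QEC.Census.Plane

set_option maxHeartbeats 400000000 in
/-- Block 1, matrix 1: largest row 89, second-largest in `[64, 69)`, ≤ 4 below — every such selection passes (3854191 lanes; KERNEL). -/
theorem pseg2_1_1_180 : Plane.seg2OK 186 13 (A1s_n186_k10_42ba7993.cert.sideZ.found.map Prod.fst) (giRows (gbRows A1s_n186_k10_42ba7993.cert.HZ A1s_n186_k10_42ba7993.bzAutData.rcZ A1s_n186_k10_42ba7993.bzAutData.LZ A1s_n186_k10_42ba7993.bzAutBlockZ1) (A1s_n186_k10_42ba7993.bzAutBlockZ1.mats.getD 1 { T := [], A := [], t := 0 })) 6 89 64 5 4565 = true := by decide +kernel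

set_option maxHeartbeats 400000000 in
/-- Block 1, matrix 1: largest row 89, second-largest in `[69, 73)`, ≤ 4 below — every such selection passes (4015838 lanes; KERNEL). -/
theorem pseg2_1_1_181 : Plane.seg2OK 186 13 (A1s_n186_k10_42ba7993.cert.sideZ.found.map Prod.fst) (giRows (gbRows A1s_n186_k10_42ba7993.cert.HZ A1s_n186_k10_42ba7993.bzAutData.rcZ A1s_n186_k10_42ba7993.bzAutData.LZ A1s_n186_k10_42ba7993.bzAutBlockZ1) (A1s_n186_k10_42ba7993.bzAutBlockZ1.mats.getD 1 { T := [], A := [], t := 0 })) 6 89 69 4 4565 = true := by decide +kernel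

set_option maxHeartbeats 400000000 in
/-- Block 1, matrix 1: largest row 89, second-largest in `[73, 76)`, ≤ 4 below — every such selection passes (3657380 lanes; KERNEL). -/
theorem pseg2_1_1_182 : Plane.seg2OK 186 13 (A1s_n186_k10_42ba7993.cert.sideZ.found.map Prod.fst) (giRows (gbRows A1s_n186_k10_42ba7993.cert.HZ A1s_n186_k10_42ba7993.bzAutData.rcZ A1s_n186_k10_42ba7993.bzAutData.LZ A1s_n186_k10_42ba7993.bzAutBlockZ1) (A1s_n186_k10_42ba7993.bzAutBlockZ1.mats.getD 1 { T := [], A := [], t := 0 })) 6 89 73 3 4565 = true := by decide +kernel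

end Summit.Ventures.QEC.Census.A1s_n186_k10_42ba7993
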